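import Mathlib.LinearAlgebra.Matrix.Kronecker
import Literature.MathematicalPhysics.QuantumLattice.FinDimSpectrumSectorGibbsLimit

/-!
# Route `JosephsonMirror` — the window double (abstract Kronecker doubles)

Helper file for support item stmt-HubbardSuperconductivity-2231 (`JmPairBridgeGivesGain`) of route
`JosephsonMirror` (sub-problem `HubbardSuperconductivity`): finite-dimensional linear algebra of
Lieb's two-layer (`W`-matrix) packaging `ψ(s,t) = W_{st}`, `(X ⊗ Y) ψ_W = ψ_{X W Yᵀ}` — pure
tensors, rows and columns under Kronecker products; Hermiticity of the window double
`H(J) = A ⊗ 1 + 1 ⊗ Aᵀ - J (D ⊗ D̄ + Dᴴ ⊗ D̄ᴴ)` (`D̄ = (Dᴴ)ᵀ`); and the abstract pair bridge ⇒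
Josephson gain `gain_le_minEnergyOn_sub`: if the window `S` consists of the two-layer vectors
supported on pairs in a common block (`P₁` or `P₂`, disjoint), `A ≥ a` on each block, and `φ`
(in `P₁`), `χ` (in `P₂`) are unit `A`-eigenvectors with eigenvalue `a`, then
`J |⟨χ, D φ⟩|² ≤ E(0) - E(J)` for `J ≥ 0` (`E(J) = minEnergyOn (H(J)) S`; lower bound `E(0) ≥ 2a`
column- and row-wise, upper bound by the trial state `(φ ⊗ φ̄ + χ ⊗ χ̄)/√2`).
Sources: E. H. Lieb, Phys. Rev. Lett. 62 (1989) 1201, eq. (4); T. Koma, H. Tasaki, J. Stat. Phys.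
76 (1994) 745; H. Tasaki (2020) §2.2. No new definitions.
-/

-- the mandated namespace `Summit.<Summit>.<Problem>.Theorems` repeats `HubbardSuperconductivity`
-- (single-problem summit, D-0017), which the `dupNamespace` linter flags on every declaration
set_option linter.dupNamespace false
namespace Summit.HubbardSuperconductivity.HubbardSuperconductivity.Theorems.JosephsonMirror

open Matrix Literature.MathematicalPhysics.QuantumLattice
open scoped Kronecker ComplexOrder

section Abstract

variable {ι : Type*} [Fintype ι] [DecidableEq ι]

omit [DecidableEq ι] in
/-- A Kronecker product acts factorwise on a pure tensor: `(X ⊗ Y)(u ⊗ v) = X u ⊗ Y v`.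
Lieb, PRL 62 (1989) 1201, eq. (4) (`(X ⊗ Y) ψ_W = ψ_{X W Yᵀ}` on rank one `W`). [folklore] -/
theorem kronecker_mulVec_tensor (X Y : Matrix ι ι ℂ) (u v : ι → ℂ) :
    (X ⊗ₖ Y) *ᵥ (fun p : ι × ι => u p.1 * v p.2) =
      fun p : ι × ι => (X *ᵥ u) p.1 * (Y *ᵥ v) p.2 := by
  funext p
  simp only [mulVec, dotProduct, Fintype.sum_prod_type, kroneckerMap_apply, Finset.sum_mul_sum]
  refine Finset.sum_congr rfl fun s _ => Finset.sum_congr rfl fun t _ => ?_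
  ring

omit [DecidableEq ι] in
/-- Inner product of pure tensors `⟨u ⊗ v, u' ⊗ v'⟩ = ⟨u, u'⟩ ⟨v, v'⟩`. [folklore] -/
theorem star_tensor_dotProduct_tensor (u v u' v' : ι → ℂ) :
    star (fun p : ι × ι => u p.1 * v p.2) ⬝ᵥ (fun p : ι × ι => u' p.1 * v' p.2) =
      (star u ⬝ᵥ u') * (star v ⬝ᵥ v') := by
  simp only [dotProduct, Fintype.sum_prod_type, Pi.star_apply, star_mul', Finset.sum_mul_sum]
  refine Finset.sum_congr rfl fun s _ => Finset.sum_congr rfl fun t _ => ?_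
  ring

omit [DecidableEq ι] in
/-- `⟨ū, w̄⟩ = conj ⟨u, w⟩` for the entrywise conjugates. [folklore] -/
theorem star_star_dotProduct_star (u w : ι → ℂ) :
    star (star u) ⬝ᵥ star w = star (star u ⬝ᵥ w) := by
  rw [star_star, star_dotProduct, star_star, dotProduct_comm]

omit [DecidableEq ι] in
/-- `⟨u ⊗ ū, w ⊗ w̄⟩ = |⟨u, w⟩|²`. [folklore] -/
theorem star_tensor_conj_dotProduct (u w : ι → ℂ) :
    star (fun p : ι × ι => u p.1 * (star u) p.2) ⬝ᵥ (fun p : ι × ι => w p.1 * (star w) p.2) =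
      ((Complex.normSq (star u ⬝ᵥ w) : ℝ) : ℂ) := by
  rw [star_tensor_dotProduct_tensor, star_star_dotProduct_star, Complex.star_def, Complex.mul_conj]

omit [DecidableEq ι] in
/-- The transpose acts on conjugate vectors as the conjugate of the adjoint:
`Yᵀ ū = conj (Yᴴ u)`. [folklore] -/
theorem transpose_mulVec_star (Y : Matrix ι ι ℂ) (u : ι → ℂ) :
    Yᵀ *ᵥ star u = star (Yᴴ *ᵥ u) := by
  rw [mulVec_transpose, star_mulVec, conjTranspose_conjTranspose]

omit [DecidableEq ι] in
/-- `(Dᴴ)ᵀ ū = conj (D u)` (the entrywise conjugate `D̄ = (Dᴴ)ᵀ` acting on `ū`). [folklore] -/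
theorem conjTranspose_transpose_mulVec_star (D : Matrix ι ι ℂ) (u : ι → ℂ) :
    Dᴴᵀ *ᵥ star u = star (D *ᵥ u) := by
  rw [transpose_mulVec_star, conjTranspose_conjTranspose]

omit [DecidableEq ι] in
/-- Rayleigh quotients of the transpose: `⟨w, Aᵀ w⟩ = ⟨w̄, A w̄⟩`. [folklore] -/
theorem star_dotProduct_transpose_mulVec (A : Matrix ι ι ℂ) (w : ι → ℂ) :
    star w ⬝ᵥ Aᵀ *ᵥ w = star (star w) ⬝ᵥ A *ᵥ star w := by
  simp only [dotProduct, mulVec, transpose_apply, Pi.star_apply, star_star, Finset.mul_sum]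
  rw [Finset.sum_comm]
  refine Finset.sum_congr rfl fun i _ => Finset.sum_congr rfl fun j _ => ?_
  ring

/-- Column `t` of a two-layer vector. (Notation only: `fun s => ψ (s, t)`.) The left factor acts
columnwise: `((X ⊗ 1) ψ)(s, t) = (X ψ(·, t)) s`. [folklore] -/
theorem kronecker_one_mulVec_apply (X : Matrix ι ι ℂ) (ψ : ι × ι → ℂ) (s t : ι) :
    ((X ⊗ₖ (1 : Matrix ι ι ℂ)) *ᵥ ψ) (s, t) = (X *ᵥ fun s' => ψ (s', t)) s := by
  simp only [mulVec, dotProduct, Fintype.sum_prod_type, kroneckerMap_apply, one_apply, mul_ite,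
    mul_one, mul_zero, ite_mul, zero_mul]
  refine Finset.sum_congr rfl fun s' _ => ?_
  rw [Finset.sum_ite_eq]
  simp

/-- The right factor acts rowwise: `((1 ⊗ Y) ψ)(s, t) = (Y ψ(s, ·)) t`. [folklore] -/
theorem one_kronecker_mulVec_apply (Y : Matrix ι ι ℂ) (ψ : ι × ι → ℂ) (s t : ι) :
    (((1 : Matrix ι ι ℂ) ⊗ₖ Y) *ᵥ ψ) (s, t) = (Y *ᵥ fun t' => ψ (s, t')) t := by
  simp only [mulVec, dotProduct, Fintype.sum_prod_type, kroneckerMap_apply, one_apply, ite_mul,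
    one_mul, zero_mul]
  rw [Finset.sum_eq_single s]
  · simp
  · intro b _ hb
    simp [Ne.symm hb]
  · simp

/-- `⟨ψ, (X ⊗ 1) ψ⟩ = Σ_t ⟨ψ(·,t), X ψ(·,t)⟩` (sum over columns). [folklore] -/
theorem star_dotProduct_kronecker_one_mulVec (X : Matrix ι ι ℂ) (ψ : ι × ι → ℂ) :
    star ψ ⬝ᵥ (X ⊗ₖ (1 : Matrix ι ι ℂ)) *ᵥ ψ =
      ∑ t, star (fun s => ψ (s, t)) ⬝ᵥ X *ᵥ (fun s => ψ (s, t)) := by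
  conv_lhs => rw [dotProduct, Fintype.sum_prod_type_right]
  refine Finset.sum_congr rfl fun t _ => ?_
  rw [dotProduct]
  refine Finset.sum_congr rfl fun s _ => ?_
  rw [kronecker_one_mulVec_apply]
  rfl

/-- `⟨ψ, (1 ⊗ Y) ψ⟩ = Σ_s ⟨ψ(s,·), Y ψ(s,·)⟩` (sum over rows). [folklore] -/
theorem star_dotProduct_one_kronecker_mulVec (Y : Matrix ι ι ℂ) (ψ : ι × ι → ℂ) :
    star ψ ⬝ᵥ ((1 : Matrix ι ι ℂ) ⊗ₖ Y) *ᵥ ψ =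
      ∑ s, star (fun t => ψ (s, t)) ⬝ᵥ Y *ᵥ (fun t => ψ (s, t)) := by
  conv_lhs => rw [dotProduct, Fintype.sum_prod_type]
  refine Finset.sum_congr rfl fun s _ => ?_
  rw [dotProduct]
  refine Finset.sum_congr rfl fun t _ => ?_
  rw [one_kronecker_mulVec_apply]
  rfl

omit [DecidableEq ι] in
/-- `‖ψ‖² = Σ_t ‖ψ(·,t)‖²`. [folklore] -/
theorem star_dotProduct_self_eq_sum_cols (ψ : ι × ι → ℂ) :
    star ψ ⬝ᵥ ψ = ∑ t, star (fun s => ψ (s, t)) ⬝ᵥ (fun s => ψ (s, t)) := by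
  rw [dotProduct, Fintype.sum_prod_type_right]
  rfl

omit [DecidableEq ι] in
/-- `‖ψ‖² = Σ_s ‖ψ(s,·)‖²`. [folklore] -/
theorem star_dotProduct_self_eq_sum_rows (ψ : ι × ι → ℂ) :
    star ψ ⬝ᵥ ψ = ∑ s, star (fun t => ψ (s, t)) ⬝ᵥ (fun t => ψ (s, t)) := by
  rw [dotProduct, Fintype.sum_prod_type]
  rfl

omit [DecidableEq ι] in
/-- `‖w̄‖² = ‖w‖²` (as the complex number `⟨w̄, w̄⟩ = ⟨w, w⟩`). [folklore] -/
theorem star_star_dotProduct_star_self (w : ι → ℂ) : star (star w) ⬝ᵥ star w = star w ⬝ᵥ w := by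
  rw [star_star, dotProduct_comm]

omit [Fintype ι] [DecidableEq ι] in
/-- The Josephson coupling `K = D ⊗ D̄ + Dᴴ ⊗ D̄ᴴ` (`D̄ = (Dᴴ)ᵀ`, `D̄ᴴ = Dᵀ`) is Hermitian. [folklore] -/
theorem isHermitian_coupling (D : Matrix ι ι ℂ) : (D ⊗ₖ Dᴴᵀ + Dᴴ ⊗ₖ Dᵀ).IsHermitian := by
  unfold Matrix.IsHermitian
  simp only [conjTranspose_add, conjTranspose_kronecker,
    conjTranspose_transpose_eq_transpose_conjTranspose, conjTranspose_conjTranspose]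
  rw [add_comm]

omit [Fintype ι] in
/-- The decoupled double `A ⊗ 1 + 1 ⊗ Aᵀ` is Hermitian for Hermitian `A`. [folklore] -/
theorem isHermitian_double {A : Matrix ι ι ℂ} (hA : A.IsHermitian) :
    (A ⊗ₖ (1 : Matrix ι ι ℂ) + (1 : Matrix ι ι ℂ) ⊗ₖ Aᵀ).IsHermitian := by
  unfold Matrix.IsHermitian
  rw [conjTranspose_add, conjTranspose_kronecker, conjTranspose_kronecker, conjTranspose_one,
    conjTranspose_transpose_eq_transpose_conjTranspose, hA.eq]

omit [Fintype ι] in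
/-- The window double `A ⊗ 1 + 1 ⊗ Aᵀ - J (D ⊗ D̄ + Dᴴ ⊗ D̄ᴴ)` is Hermitian (real `J`). [folklore] -/
theorem isHermitian_windowDouble {A : Matrix ι ι ℂ} (hA : A.IsHermitian) (D : Matrix ι ι ℂ)
    (J : ℝ) :
    (A ⊗ₖ (1 : Matrix ι ι ℂ) + (1 : Matrix ι ι ℂ) ⊗ₖ Aᵀ -
      (J : ℂ) • (D ⊗ₖ Dᴴᵀ + Dᴴ ⊗ₖ Dᵀ)).IsHermitian :=
  (isHermitian_double hA).sub ((isHermitian_coupling D).smul (Complex.conj_ofReal J))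

omit [DecidableEq ι] in
/-- A pure tensor `u ⊗ ū` of an `A`-eigenvector with real eigenvalue `a` is an eigenvector of
`A ⊗ 1 + 1 ⊗ Aᵀ` with eigenvalue `2a` (`Aᵀ ū = conj (A u)` for Hermitian `A`). [folklore] -/
theorem double_mulVec_tensor_conj [DecidableEq ι] {A : Matrix ι ι ℂ} (hA : A.IsHermitian)
    {u : ι → ℂ} {a : ℝ} (hu : A *ᵥ u = (a : ℂ) • u) :
    (A ⊗ₖ (1 : Matrix ι ι ℂ) + (1 : Matrix ι ι ℂ) ⊗ₖ Aᵀ) *ᵥ (fun p : ι × ι => u p.1 * (star u) p.2) =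
      ((2 * a : ℝ) : ℂ) • fun p : ι × ι => u p.1 * (star u) p.2 := by
  have hT : Aᵀ *ᵥ star u = (a : ℂ) • star u := by
    rw [transpose_mulVec_star, hA.eq, hu, star_smul, Complex.star_def, Complex.conj_ofReal]
  rw [add_mulVec, kronecker_mulVec_tensor, kronecker_mulVec_tensor, hu, hT, one_mulVec, one_mulVec]
  funext p
  simp only [Pi.add_apply, Pi.smul_apply, smul_eq_mul]
  push_cast
  ring

omit [DecidableEq ι] in
/-- The Josephson coupling on the trial vector: for `v = φ ⊗ φ̄ + χ ⊗ χ̄`,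
`⟨v, (X ⊗ X̄) v⟩ = Σ_{u,w ∈ {φ,χ}} |⟨u, X w⟩|² ≥ |⟨χ, X φ⟩|²` (`X̄ = (Xᴴ)ᵀ`). [folklore] -/
theorem normSq_le_re_coupling_trial (X : Matrix ι ι ℂ) (φ χ : ι → ℂ) :
    ‖star χ ⬝ᵥ X *ᵥ φ‖ ^ 2 ≤
      (star ((fun p : ι × ι => φ p.1 * (star φ) p.2) + fun p : ι × ι => χ p.1 * (star χ) p.2) ⬝ᵥ
        (X ⊗ₖ Xᴴᵀ) *ᵥ
          ((fun p : ι × ι => φ p.1 * (star φ) p.2) + fun p : ι × ι => χ p.1 * (star χ) p.2)).re := by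
  have hX : ∀ u : ι → ℂ, (X ⊗ₖ Xᴴᵀ) *ᵥ (fun p : ι × ι => u p.1 * (star u) p.2) =
      fun p : ι × ι => (X *ᵥ u) p.1 * (star (X *ᵥ u)) p.2 := by
    intro u
    rw [kronecker_mulVec_tensor, conjTranspose_transpose_mulVec_star]
  rw [mulVec_add, hX, hX, star_add, add_dotProduct, dotProduct_add, dotProduct_add,
    star_tensor_conj_dotProduct, star_tensor_conj_dotProduct, star_tensor_conj_dotProduct,
    star_tensor_conj_dotProduct]
  simp only [Complex.add_re, Complex.ofReal_re]
  rw [← Complex.normSq_eq_norm_sq]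
  nlinarith [Complex.normSq_nonneg (star φ ⬝ᵥ X *ᵥ φ), Complex.normSq_nonneg (star φ ⬝ᵥ X *ᵥ χ),
    Complex.normSq_nonneg (star χ ⬝ᵥ X *ᵥ χ)]

omit [DecidableEq ι] in
/-- `⟨φ, Xᴴ χ⟩ = conj ⟨χ, X φ⟩`, hence the same modulus. [folklore] -/
theorem norm_star_dotProduct_conjTranspose_mulVec (X : Matrix ι ι ℂ) (φ χ : ι → ℂ) :
    ‖star φ ⬝ᵥ Xᴴ *ᵥ χ‖ = ‖star χ ⬝ᵥ X *ᵥ φ‖ := by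
  have h : star φ ⬝ᵥ Xᴴ *ᵥ χ = star (star χ ⬝ᵥ X *ᵥ φ) := by
    rw [star_dotProduct, star_mulVec, conjTranspose_conjTranspose, ← dotProduct_mulVec]
  rw [h, norm_star]

/-- **Abstract pair bridge ⇒ Josephson gain.** Let `A` be Hermitian, `D` arbitrary, and let the
window `S` consist of the two-layer vectors supported on pairs `(s, t)` lying in a common block
(`P₁` or `P₂`, disjoint), where `A ≥ a` on the vectors supported in either block. If `φ`
(supported in `P₁`) and `χ` (supported in `P₂`) are unit eigenvectors of `A` with the common
eigenvalue `a`, then for `J ≥ 0` the lowest energy of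
`H(J) = A ⊗ 1 + 1 ⊗ Aᵀ - J (D ⊗ D̄ + Dᴴ ⊗ D̄ᴴ)` on `S` drops at least linearly:
`J |⟨χ, D φ⟩|² ≤ E(0) - E(J)`. Lower bound `E(0) ≥ 2a` column- and row-wise; upper bound by the
trial state `(φ ⊗ φ̄ + χ ⊗ χ̄)/√2`. Koma–Tasaki, J. Stat. Phys. 76 (1994) 745 (LRO ⇒ SSB);
Lieb, PRL 62 (1989) 1201 (the `W`-matrix packaging). [folklore] -/
theorem gain_le_minEnergyOn_sub (A D : Matrix ι ι ℂ) (hA : A.IsHermitian)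
    (P₁ P₂ : ι → Prop) (h12 : ∀ s, P₁ s → ¬ P₂ s)
    (good : ι × ι → Prop) (hgood : ∀ s t, good (s, t) → (P₁ s ∧ P₁ t) ∨ (P₂ s ∧ P₂ t))
    (hgood₁ : ∀ s t, P₁ s → P₁ t → good (s, t)) (hgood₂ : ∀ s t, P₂ s → P₂ t → good (s, t))
    (S : Submodule ℂ (ι × ι → ℂ)) (hS : ∀ ψ, ψ ∈ S ↔ ∀ p, ¬ good p → ψ p = 0)
    (a : ℝ)
    (hA₁ : ∀ v : ι → ℂ, (∀ s, ¬ P₁ s → v s = 0) → a * (star v ⬝ᵥ v).re ≤ (star v ⬝ᵥ A *ᵥ v).re)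
    (hA₂ : ∀ v : ι → ℂ, (∀ s, ¬ P₂ s → v s = 0) → a * (star v ⬝ᵥ v).re ≤ (star v ⬝ᵥ A *ᵥ v).re)
    (φ χ : ι → ℂ) (hφP : ∀ s, ¬ P₁ s → φ s = 0) (hχP : ∀ s, ¬ P₂ s → χ s = 0)
    (hφ1 : star φ ⬝ᵥ φ = 1) (hχ1 : star χ ⬝ᵥ χ = 1)
    (hAφ : A *ᵥ φ = (a : ℂ) • φ) (hAχ : A *ᵥ χ = (a : ℂ) • χ) {J : ℝ} (hJ : 0 ≤ J) :
    J * ‖star χ ⬝ᵥ D *ᵥ φ‖ ^ 2 ≤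
      (A ⊗ₖ (1 : Matrix ι ι ℂ) + (1 : Matrix ι ι ℂ) ⊗ₖ Aᵀ -
          ((0 : ℝ) : ℂ) • (D ⊗ₖ Dᴴᵀ + Dᴴ ⊗ₖ Dᵀ)).minEnergyOn S -
        (A ⊗ₖ (1 : Matrix ι ι ℂ) + (1 : Matrix ι ι ℂ) ⊗ₖ Aᵀ -
          (J : ℂ) • (D ⊗ₖ Dᴴᵀ + Dᴴ ⊗ₖ Dᵀ)).minEnergyOn S := by
  -- notation
  set H₀ : Matrix (ι × ι) (ι × ι) ℂ := A ⊗ₖ (1 : Matrix ι ι ℂ) + (1 : Matrix ι ι ℂ) ⊗ₖ Aᵀ with hH₀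
  set K : Matrix (ι × ι) (ι × ι) ℂ := D ⊗ₖ Dᴴᵀ + Dᴴ ⊗ₖ Dᵀ with hK
  -- (1) block lower bound for vectors supported in one block (or in `P₁` vacuously)
  have hblock : ∀ w : ι → ℂ, ((∀ t, ¬ P₁ t → w t = 0) ∨ (∀ t, ¬ P₂ t → w t = 0)) →
      a * (star w ⬝ᵥ w).re ≤ (star w ⬝ᵥ A *ᵥ w).re := by
    intro w hw
    rcases hw with hw | hw
    · exact hA₁ w hw
    · exact hA₂ w hw
  -- supports of columns and rows of window vectors
  have hcol : ∀ ψ ∈ S, ∀ t, (∀ s, ¬ P₁ s → ψ (s, t) = 0) ∨ (∀ s, ¬ P₂ s → ψ (s, t) = 0) := by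
    intro ψ hψ t
    have hz : ∀ s, ¬ good (s, t) → ψ (s, t) = 0 := fun s hs => (hS ψ).1 hψ (s, t) hs
    by_cases h1 : P₁ t
    · refine Or.inl fun s hs => hz s fun hg => ?_
      rcases hgood s t hg with ⟨hs', -⟩ | ⟨-, ht'⟩
      · exact hs hs'
      · exact h12 t h1 ht'
    · by_cases h2 : P₂ t
      · refine Or.inr fun s hs => hz s fun hg => ?_
        rcases hgood s t hg with ⟨-, ht'⟩ | ⟨hs', -⟩
        · exact h1 ht'
        · exact hs hs'
      · refine Or.inl fun s _ => hz s fun hg => ?_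
        rcases hgood s t hg with ⟨-, ht'⟩ | ⟨-, ht'⟩
        · exact h1 ht'
        · exact h2 ht'
  have hrow : ∀ ψ ∈ S, ∀ s, (∀ t, ¬ P₁ t → ψ (s, t) = 0) ∨ (∀ t, ¬ P₂ t → ψ (s, t) = 0) := by
    intro ψ hψ s
    have hz : ∀ t, ¬ good (s, t) → ψ (s, t) = 0 := fun t ht => (hS ψ).1 hψ (s, t) ht
    by_cases h1 : P₁ s
    · refine Or.inl fun t ht => hz t fun hg => ?_
      rcases hgood s t hg with ⟨-, ht'⟩ | ⟨hs', -⟩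
      · exact ht ht'
      · exact h12 s h1 hs'
    · by_cases h2 : P₂ s
      · refine Or.inr fun t ht => hz t fun hg => ?_
        rcases hgood s t hg with ⟨hs', -⟩ | ⟨-, ht'⟩
        · exact h1 hs'
        · exact ht ht'
      · refine Or.inl fun t _ => hz t fun hg => ?_
        rcases hgood s t hg with ⟨hs', -⟩ | ⟨hs', -⟩
        · exact h1 hs'
        · exact h2 hs'
  -- (2) lower bound `2a ‖ψ‖² ≤ Re ⟨ψ, H₀ ψ⟩` on the window
  have hlow : ∀ ψ ∈ S, 2 * a * (star ψ ⬝ᵥ ψ).re ≤ (star ψ ⬝ᵥ H₀ *ᵥ ψ).re := by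
    intro ψ hψ
    have hc : a * (star ψ ⬝ᵥ ψ).re ≤ (star ψ ⬝ᵥ (A ⊗ₖ (1 : Matrix ι ι ℂ)) *ᵥ ψ).re := by
      rw [star_dotProduct_kronecker_one_mulVec, star_dotProduct_self_eq_sum_cols, Complex.re_sum,
        Complex.re_sum, Finset.mul_sum]
      exact Finset.sum_le_sum fun t _ => hblock _ (hcol ψ hψ t)
    have hr : a * (star ψ ⬝ᵥ ψ).re ≤ (star ψ ⬝ᵥ ((1 : Matrix ι ι ℂ) ⊗ₖ Aᵀ) *ᵥ ψ).re := by
      rw [star_dotProduct_one_kronecker_mulVec, star_dotProduct_self_eq_sum_rows, Complex.re_sum,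
        Complex.re_sum, Finset.mul_sum]
      refine Finset.sum_le_sum fun s _ => ?_
      rw [star_dotProduct_transpose_mulVec, ← star_star_dotProduct_star_self]
      refine hblock (star fun t => ψ (s, t)) ?_
      rcases hrow ψ hψ s with h | h
      · exact Or.inl fun t ht => by simp [h t ht]
      · exact Or.inr fun t ht => by simp [h t ht]
    rw [hH₀, add_mulVec, dotProduct_add, Complex.add_re]
    linarith
  -- (3) the trial vector `v = φ ⊗ φ̄ + χ ⊗ χ̄`
  set v : ι × ι → ℂ :=
    (fun p : ι × ι => φ p.1 * (star φ) p.2) + fun p : ι × ι => χ p.1 * (star χ) p.2 with hv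
  have hφχ : star φ ⬝ᵥ χ = 0 := by
    rw [dotProduct]
    refine Finset.sum_eq_zero fun s _ => ?_
    by_cases h1 : P₁ s
    · rw [hχP s (h12 s h1), mul_zero]
    · rw [Pi.star_apply, hφP s h1, star_zero, zero_mul]
  have hχφ : star χ ⬝ᵥ φ = 0 := by
    have := congrArg star hφχ
    rwa [star_dotProduct, star_star, star_zero] at this
  have hvv : star v ⬝ᵥ v = 2 := by
    rw [hv, star_add, add_dotProduct, dotProduct_add, dotProduct_add, star_tensor_conj_dotProduct,
      star_tensor_conj_dotProduct, star_tensor_conj_dotProduct, star_tensor_conj_dotProduct, hφ1,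
      hχ1, hφχ, hχφ]
    simp
    norm_num
  have hvS : v ∈ S := by
    refine (hS v).2 fun p hp => ?_
    obtain ⟨s, t⟩ := p
    have h1 : φ s * (star φ) t = 0 := by
      by_cases hs : P₁ s
      · by_cases ht : P₁ t
        · exact absurd (hgood₁ s t hs ht) hp
        · rw [Pi.star_apply, hφP t ht, star_zero, mul_zero]
      · rw [hφP s hs, zero_mul]
    have h2 : χ s * (star χ) t = 0 := by
      by_cases hs : P₂ s
      · by_cases ht : P₂ t
        · exact absurd (hgood₂ s t hs ht) hp
        · rw [Pi.star_apply, hχP t ht, star_zero, mul_zero]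
      · rw [hχP s hs, zero_mul]
    simp only [hv, Pi.add_apply, h1, h2, add_zero]
  have hH₀v : H₀ *ᵥ v = ((2 * a : ℝ) : ℂ) • v := by
    rw [hH₀, hv, mulVec_add, double_mulVec_tensor_conj hA hAφ, double_mulVec_tensor_conj hA hAχ,
      smul_add]
  have hKv : 2 * ‖star χ ⬝ᵥ D *ᵥ φ‖ ^ 2 ≤ (star v ⬝ᵥ K *ᵥ v).re := by
    have h1 := normSq_le_re_coupling_trial D φ χ
    have h2 := normSq_le_re_coupling_trial Dᴴ χ φ
    rw [conjTranspose_conjTranspose, norm_star_dotProduct_conjTranspose_mulVec] at h2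
    have h2' : ‖star χ ⬝ᵥ D *ᵥ φ‖ ^ 2 ≤ (star v ⬝ᵥ (Dᴴ ⊗ₖ Dᵀ) *ᵥ v).re := by
      rw [hv, add_comm]
      exact h2
    rw [hK, add_mulVec, dotProduct_add, Complex.add_re]
    rw [hv] at h2' ⊢
    rw [← hv] at h2' ⊢
    linarith [h1]
  -- (4) the normalised trial state `Ψ = v / √2`
  set c : ℂ := (((Real.sqrt 2)⁻¹ : ℝ) : ℂ) with hc
  have hcc : star c * c = (1 / 2 : ℝ) := by
    rw [hc, Complex.star_def, Complex.conj_ofReal, ← Complex.ofReal_mul]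
    congr 1
    rw [← mul_inv, Real.mul_self_sqrt (by norm_num : (0 : ℝ) ≤ 2)]
    norm_num
  set Ψ : ι × ι → ℂ := c • v with hΨ
  have hΨS : Ψ ∈ S := S.smul_mem c hvS
  have hΨM : ∀ M : Matrix (ι × ι) (ι × ι) ℂ,
      star Ψ ⬝ᵥ M *ᵥ Ψ = ((1 / 2 : ℝ) : ℂ) * (star v ⬝ᵥ M *ᵥ v) := by
    intro M
    rw [hΨ, mulVec_smul, star_smul, smul_dotProduct, dotProduct_smul, smul_smul, hcc, smul_eq_mul]
  have hΨ1 : star Ψ ⬝ᵥ Ψ = 1 := by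
    have h := hΨM 1
    rw [one_mulVec, one_mulVec, hvv] at h
    rw [h]
    push_cast
    ring
  -- (5) upper bound on `E(J)` by the trial state
  have hHerm := isHermitian_windowDouble hA D J
  have hup : (H₀ - (J : ℂ) • K).minEnergyOn S ≤ 2 * a - J * ‖star χ ⬝ᵥ D *ᵥ φ‖ ^ 2 := by
    refine (minEnergyOn_le_rayleigh_of_mem hHerm S hΨS hΨ1).trans ?_
    rw [sub_mulVec, dotProduct_sub, Complex.sub_re, hΨM, hΨM, hH₀v, dotProduct_smul, hvv,
      smul_mulVec, dotProduct_smul, smul_eq_mul, smul_eq_mul]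
    have hre : (((1 / 2 : ℝ) : ℂ) * ((J : ℂ) * (star v ⬝ᵥ K *ᵥ v))).re =
        1 / 2 * J * (star v ⬝ᵥ K *ᵥ v).re := by
      rw [← mul_assoc, ← Complex.ofReal_mul, Complex.re_ofReal_mul]
    rw [hre]
    have h2a : (((1 / 2 : ℝ) : ℂ) * (((2 * a : ℝ) : ℂ) * 2)).re = 2 * a := by
      rw [← Complex.ofReal_ofNat, ← Complex.ofReal_mul, ← Complex.ofReal_mul, Complex.ofReal_re]
      ring
    rw [h2a]
    nlinarith [hKv, hJ]
  -- (6) lower bound on `E(0)`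
  have hlow0 : 2 * a ≤ (H₀ - ((0 : ℝ) : ℂ) • K).minEnergyOn S := by
    rw [Complex.ofReal_zero, zero_smul, sub_zero]
    refine le_csInf ⟨(star Ψ ⬝ᵥ H₀ *ᵥ Ψ).re, Ψ, hΨS, hΨ1, rfl⟩ ?_
    rintro E ⟨ψ, hψS, hψ1, rfl⟩
    have h := hlow ψ hψS
    rw [hψ1, Complex.one_re, mul_one] at h
    exact h
  linarith

end Abstract

end Summit.HubbardSuperconductivity.HubbardSuperconductivity.Theorems.JosephsonMirror
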